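import Literature.Analysis.FluidPDE.TaoCascadeModeDuhamel
import Literature.Analysis.FunctionSpaces.FourierSobolevNormEmbeddingProofs

/-!
# Crux `PerpetualPump.AveragedTypeIBlowup` (stmt-NavierStokesRegularity-1835), line `Sketch`:
# stub `supBound` — the sup norm of a cascade mild solution through the Fourier side

T. Tao, *Finite time blowup for an averaged three-dimensional Navier–Stokes equation*, J. Amer.
Math. Soc. **29** (2016), 601–674 = arXiv:1402.0290v3, §4, proof of Lemma 4.1, p. 22:
"Taking Fourier transforms … As these dilated balls are disjoint, we thus have a decomposition
`u(t) = ∑ₙ ∑ᵢ u_{i,n}(t)`".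

For a mild solution `u` of the cascade equation (3.3)/(4.1) on `[0,S)` whose datum lies in the
span of the wavelets (here `A ψ_{i₀,n₀}`), this file proves:

* `isBandLimited_iUnion_freqRegion` — **off-band vanishing**: `û(t) = 0` a.e. off the union `U`
  of the (pairwise disjoint) mode regions `(1+ε₀)ⁿ(Bᵢ ∪ -Bᵢ)`. The Fourier projection `Q` of
  `u(t)` onto `Uᶜ` lies in `H¹⁰_df` (even real symbol), every wavelet pairs to zero with a
  field band-limited to `Uᶜ`, so in the mild identity tested with `Q` the datum term and the
  cascade integrand vanish: `⟨u(t), Q⟩ = 0 = ⟪Q, Q⟫`.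
* `lintegral_freqRegion_enorm_fourierFn_le` — **Cauchy–Schwarz on one region**:
  `∫_{R_{i,n}} |û| ≤ |R_{i,n}|^{1/2} ‖u_{i,n}‖ ≤ c (1+ε₀)^{3n/2} ‖u_{i,n}‖`, with
  `c = ((1+ε₀/2)³ |B(0,1)|)^{1/2}` (`R_{i,n} ⊆ B(0, (1+ε₀)ⁿ(1+ε₀/2))`).
* `eLpNorm_top_le_of_isBandLimited` — **`‖u‖_∞ ≤ ‖û‖_{L¹} ≤ c Σ_{i,n} (1+ε₀)^{3n/2} ‖u_{i,n}‖`**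
  for a field band-limited to `U` (in `ℝ≥0∞`, no summability assumed; the `L^∞` bound by the
  `L¹` norm of the Fourier transform is the accepted `SobolevEmbeddingHalf.enorm_fourierInv_toLp_le`).
* `stub_supBound` — the registered stub of the line's skeleton, verbatim.

Nothing here closes the item (`--supports`); no statement of the route changes.

## References

* T. Tao, J. Amer. Math. Soc. 29 (2016), 601–674, arXiv:1402.0290v3, §4 Lemma 4.1, p. 22.
  [`Tao2016AveragedNS`]
* J.-Y. Chemin, C.-J. Xu, Ann. Sci. ÉNS (4) 30 (1997), Introduction (9) (the `L¹`-Fourier sup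
  bound). [`CheminXu1997`]
-/

noncomputable section

-- the summit namespace `…NavierStokesRegularity.NavierStokesRegularity…` is the tree convention
set_option linter.dupNamespace false

open MeasureTheory Set Filter Topology FourierTransform Metric
open scoped ENNReal
open scoped InnerProductSpace
open Literature.Analysis.FluidPDE Literature.Analysis.FluidPDE.Tao2016
open Literature.Analysis.FluidPDE.TaoCascade (quadTerm IsSymmetricCoeff IsCancellingCoeff)
open Literature.Analysis.FunctionSpaces

namespace Summit.NavierStokesRegularity.NavierStokesRegularity.Theorems.PerpetualPumpAveragedTypeIBlowup

variable {ε₀ : ℝ} {m : ℕ}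

/-! ### Fields band-limited off all mode regions -/

/-- The union of the mode regions is measurable (a countable union of open sets). [folklore] -/
theorem measurableSet_iUnion_freqRegion (𝒟 : CascadeWaveletData ε₀ m) :
    MeasurableSet (⋃ p : Fin m × ℤ, freqRegion 𝒟 p.1 p.2) :=
  MeasurableSet.iUnion fun p => measurableSet_freqRegion 𝒟 p.1 p.2

/-- The complement of the union of the mode regions is symmetric under `ξ ↦ -ξ`. [folklore] -/
theorem mem_compl_iUnion_freqRegion_iff_neg (𝒟 : CascadeWaveletData ε₀ m)
    (ξ : EuclideanSpace ℝ (Fin 3)) :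
    ξ ∈ (⋃ p : Fin m × ℤ, freqRegion 𝒟 p.1 p.2)ᶜ ↔ -ξ ∈ (⋃ p : Fin m × ℤ, freqRegion 𝒟 p.1 p.2)ᶜ := by
  simp only [mem_compl_iff, mem_iUnion, neg_mem_freqRegion_iff]

/-- The Fourier projection `1_R(D)` onto a symmetric measurable frequency set maps `H¹⁰_df` to
itself (finite `H¹⁰` norm, realness for an even real symbol, divergence-freeness). [folklore] -/
theorem memH10df_bandProj {R : Set (EuclideanSpace ℝ (Fin 3))} (hR : MeasurableSet R)
    (hRsymm : ∀ ξ, ξ ∈ R ↔ -ξ ∈ R) {f : L2C} (hf : MemH10df f) : MemH10df (bandProj hR f) :=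
  ⟨(hf.memH10dfC.fourierMultiplier _).1, hf.2.1.bandProj hR hRsymm, hf.2.2.bandProj hR⟩

/-- **A field band-limited off all mode regions pairs to zero with every wavelet** (the wavelet
`ψ_{j,k}` is band-limited to its region; Parseval). [cite: Tao2016AveragedNS, §4 Lemma 4.1 p. 22] -/
theorem pairing_cascadeWavelet_eq_zero_of_offBand (hε : 0 < 1 + ε₀) (𝒟 : CascadeWaveletData ε₀ m)
    {w : L2C} (hw : IsBandLimited (⋃ p : Fin m × ℤ, freqRegion 𝒟 p.1 p.2)ᶜ w) (j : Fin m) (k : ℤ) :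
    pairing w (cascadeWavelet ε₀ (𝒟.ψ j) k) = 0 := by
  rw [pairing_eq_inner (isReal_cascadeWavelet ε₀ (𝒟.ψ j) k)]
  refine (hw.inner_eq_zero_of_ae ?_).2
  filter_upwards [𝒟.fourierFn_cascadeWavelet_eq_zero hε j k] with ξ h hξ
  exact h fun h' => hξ (mem_iUnion.2 ⟨(j, k), h'⟩)

/-- **The cascade operator tested against a field band-limited off all mode regions vanishes**:
every term of (4.1) carries a factor `⟨g, ψ_{i₃,n+μ₃}⟩ = 0`. [cite: Tao2016AveragedNS, §4 (4.1)] -/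
theorem cascadeOperatorForm_eq_zero_of_offBand (hε : 0 < 1 + ε₀) (𝒟 : CascadeWaveletData ε₀ m)
    (α : Fin m → Fin m → Fin m → ℤ × ℤ × ℤ → ℝ) (f : L2C) {g : L2C}
    (hg : IsBandLimited (⋃ p : Fin m × ℤ, freqRegion 𝒟 p.1 p.2)ᶜ g) :
    cascadeOperatorForm ε₀ 𝒟.ψ α f f g = 0 := by
  unfold cascadeOperatorForm
  refine Finset.sum_eq_zero fun i₁ _ => Finset.sum_eq_zero fun i₂ _ =>
    Finset.sum_eq_zero fun i₃ _ => Finset.sum_eq_zero fun μ _ => ?_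
  have h0 : ∀ n : ℤ, (((1 + ε₀) ^ ((5 : ℝ) * (n : ℝ) / 2) : ℝ) : ℂ) *
      (pairing f (cascadeWavelet ε₀ (𝒟.ψ i₁) (n + μ.1)) *
        pairing f (cascadeWavelet ε₀ (𝒟.ψ i₂) (n + μ.2.1)) *
          pairing g (cascadeWavelet ε₀ (𝒟.ψ i₃) (n + μ.2.2))) = 0 := fun n => by
    rw [pairing_cascadeWavelet_eq_zero_of_offBand hε 𝒟 hg i₃ (n + μ.2.2), mul_zero, mul_zero]
  simp only [h0, tsum_zero, mul_zero]

/-- A field band-limited off all regions is orthogonal to a field band-limited to the union of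
the regions. [folklore] -/
theorem inner_eq_zero_of_offBand (𝒟 : CascadeWaveletData ε₀ m) {w g : L2C}
    (hw : IsBandLimited (⋃ p : Fin m × ℤ, freqRegion 𝒟 p.1 p.2)ᶜ w)
    (hg : IsBandLimited (⋃ p : Fin m × ℤ, freqRegion 𝒟 p.1 p.2) g) :
    ⟪w, g⟫_ℂ = 0 ∧ ⟪g, w⟫_ℂ = 0 :=
  hw.inner_eq_zero_of_ae (by filter_upwards [hg] with ξ h hξ; exact h hξ)

/-- If the projection of `f` onto `Rᶜ` vanishes then `f` is band-limited to `R`. [folklore] -/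
theorem isBandLimited_of_bandProj_compl_eq_zero {R : Set (EuclideanSpace ℝ (Fin 3))}
    (hRc : MeasurableSet Rᶜ) {f : L2C} (h : bandProj hRc f = 0) : IsBandLimited R f := by
  unfold IsBandLimited
  have h1 := fourierFn_fourierMultiplier ((memLp_top_indicator_one hRc).toLp _) f
  rw [← bandProj_apply hRc, h] at h1
  filter_upwards [h1, fourierFn_zero, MemLp.coeFn_toLp (memLp_top_indicator_one hRc)]
    with ξ h1 h2 h3 hξ
  rw [h2, Pi.zero_apply, h3, indicator_of_mem (mem_compl hξ), one_smul] at h1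
  exact h1.symm

/-! ### Off-band vanishing for a mild solution with datum in the span of the wavelets -/

section OffBand

variable (hε₀ : 0 < ε₀) (𝒟 : CascadeWaveletData ε₀ m)
  (α : Fin m → Fin m → Fin m → ℤ × ℤ × ℤ → ℝ) (i₀ : Fin m) (n₀ : ℤ) (A S : ℝ) (u : ℝ → L2C)
  (hu : IsMildSolutionFor (cascadeOperatorForm ε₀ 𝒟.ψ α) ((A : ℂ) • cascadeWavelet ε₀ (𝒟.ψ i₀) n₀)
    (Ico 0 S) u)
  {t : ℝ} (ht : t ∈ Ico 0 S)

include hε₀ hu ht in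
/-- **Off-band vanishing** (Tao, p. 22: "we thus have a decomposition `u(t) = ∑ₙ ∑ᵢ u_{i,n}(t)`"):
for a mild solution of the cascade equation on `[0,S)` with datum `A ψ_{i₀,n₀}` and `t ∈ [0,S)`,
`û(t)` vanishes a.e. off the union `U` of the mode regions. With `Q = 1_{Uᶜ}(D) u(t) ∈ H¹⁰_df`
as test field, the datum term `⟨e^{tΔ} A ψ_{i₀,n₀}, Q⟩` and the cascade integrand
`⟨C(u,u), e^{(t-s)Δ} Q⟩` of the mild identity vanish (disjoint Fourier supports), so
`⟪Q, Q⟫ = ⟨u(t), Q⟩ = 0`. [cite: Tao2016AveragedNS, §4 Lemma 4.1 p. 22] -/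
theorem isBandLimited_iUnion_freqRegion :
    IsBandLimited (⋃ p : Fin m × ℤ, freqRegion 𝒟 p.1 p.2) (u t) := by
  have hε : 0 < 1 + ε₀ := by linarith
  have ht0 : (0 : ℝ) ≤ t := ht.1
  have hU : MeasurableSet (⋃ p : Fin m × ℤ, freqRegion 𝒟 p.1 p.2) :=
    measurableSet_iUnion_freqRegion 𝒟
  have hUc : MeasurableSet (⋃ p : Fin m × ℤ, freqRegion 𝒟 p.1 p.2)ᶜ := hU.compl
  set Q : L2C := bandProj hUc (u t) with hQdef
  have hQ : MemH10df Q := memH10df_bandProj hUc (mem_compl_iUnion_freqRegion_iff_neg 𝒟) (hu.1 t ht)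
  have hQb : IsBandLimited (⋃ p : Fin m × ℤ, freqRegion 𝒟 p.1 p.2)ᶜ Q :=
    isBandLimited_bandProj hUc (u t)
  -- the datum, propagated by the heat flow, is band-limited to the union of the regions
  have ha : IsBandLimited (⋃ p : Fin m × ℤ, freqRegion 𝒟 p.1 p.2)
      (heat t ((A : ℂ) • cascadeWavelet ε₀ (𝒟.ψ i₀) n₀)) :=
    (heat_isBandLimited ((cascadeWavelet_isBandLimited hε 𝒟 i₀ n₀).smul _) t).mono
      (subset_iUnion (fun p : Fin m × ℤ => freqRegion 𝒟 p.1 p.2) (i₀, n₀))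
  -- the mild identity tested with `Q`: both terms vanish
  have hpair : pairing (u t) Q = 0 := by
    rw [hu.2.2 t ht Q hQ, pairing_eq_inner hQ.2.1, (inner_eq_zero_of_offBand 𝒟 hQb ha).1, zero_add]
    refine intervalIntegral.integral_zero_ae (Eventually.of_forall fun s _ => ?_)
    exact cascadeOperatorForm_eq_zero_of_offBand hε 𝒟 α (u s) (heat_isBandLimited hQb (t - s))
  -- hence `⟪Q, Q⟫ = ⟪Q, u t⟫ = ⟨u t, Q⟩ = 0`
  have hself : ⟪Q, Q⟫_ℂ = 0 := by
    have h1 : ⟪Q, u t⟫_ℂ = ⟪Q, Q⟫_ℂ := by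
      conv_lhs => rw [← hQb.bandProj_eq hUc]
      rw [inner_bandProj_comm, ← hQdef]
    rw [← h1, ← pairing_eq_inner hQ.2.1, hpair]
  exact isBandLimited_of_bandProj_compl_eq_zero hUc (inner_self_eq_zero.1 hself)

end OffBand

/-! ### Cauchy–Schwarz on one region -/

/-- **The volume of a mode region**: `|R_{i,n}|^{1/2} ≤ c (1+ε₀)^{3n/2}` with
`c = ((1+ε₀/2)³ |B(0,1)|)^{1/2}`, since `R_{i,n} ⊆ B(0, (1+ε₀)ⁿ(1+ε₀/2))`. [cite: Tao2016AveragedNS, §4 Lemma 4.1 p. 22] -/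
theorem volume_freqRegion_rpow_half_le (hε₀ : 0 < ε₀) (𝒟 : CascadeWaveletData ε₀ m) (i : Fin m)
    (n : ℤ) :
    (volume (freqRegion 𝒟 i n)) ^ (1 / 2 : ℝ) ≤
      ENNReal.ofReal (Real.sqrt ((1 + ε₀ / 2) ^ 3 *
          (volume (ball (0 : EuclideanSpace ℝ (Fin 3)) 1)).toReal) *
        (1 + ε₀) ^ ((3 : ℝ) * n / 2)) := by
  have hε : 0 < 1 + ε₀ := by linarith
  have hc : 0 < (1 + ε₀) ^ n := zpow_pos hε n
  set V₁ : ℝ≥0∞ := volume (ball (0 : EuclideanSpace ℝ (Fin 3)) 1) with hV₁def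
  have hV₁ : V₁ ≠ ⊤ := measure_ball_lt_top.ne
  have hr : 0 ≤ (1 + ε₀) ^ n * (1 + ε₀ / 2) := by positivity
  have h1 : volume (freqRegion 𝒟 i n) ≤
      ENNReal.ofReal (((1 + ε₀) ^ n * (1 + ε₀ / 2)) ^ 3 * V₁.toReal) := by
    calc volume (freqRegion 𝒟 i n)
        ≤ volume (closedBall (0 : EuclideanSpace ℝ (Fin 3)) ((1 + ε₀) ^ n * (1 + ε₀ / 2))) :=
          measure_mono (freqRegion_subset_closedBall hε 𝒟 i n)
      _ = ENNReal.ofReal (((1 + ε₀) ^ n * (1 + ε₀ / 2)) ^ 3) * V₁ := by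
          rw [Measure.addHaar_closedBall _ _ hr, finrank_euclideanSpace_fin]
      _ = ENNReal.ofReal (((1 + ε₀) ^ n * (1 + ε₀ / 2)) ^ 3 * V₁.toReal) := by
          rw [ENNReal.ofReal_mul' ENNReal.toReal_nonneg, ENNReal.ofReal_toReal hV₁]
  calc (volume (freqRegion 𝒟 i n)) ^ (1 / 2 : ℝ)
      ≤ (ENNReal.ofReal (((1 + ε₀) ^ n * (1 + ε₀ / 2)) ^ 3 * V₁.toReal)) ^ (1 / 2 : ℝ) :=
        ENNReal.rpow_le_rpow h1 (by norm_num)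
    _ = ENNReal.ofReal ((((1 + ε₀) ^ n * (1 + ε₀ / 2)) ^ 3 * V₁.toReal) ^ (1 / 2 : ℝ)) :=
        ENNReal.ofReal_rpow_of_nonneg (by positivity) (by norm_num)
    _ = ENNReal.ofReal (Real.sqrt ((1 + ε₀ / 2) ^ 3 * V₁.toReal) * (1 + ε₀) ^ ((3 : ℝ) * n / 2)) := by
        congr 1
        rw [← Real.sqrt_eq_rpow, mul_pow, mul_assoc, Real.sqrt_mul (by positivity), mul_comm]
        congr 1
        rw [Real.sqrt_eq_rpow, ← Real.rpow_intCast, ← Real.rpow_natCast, ← Real.rpow_mul hε.le,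
          ← Real.rpow_mul hε.le]
        congr 1
        push_cast
        ring

/-- **Cauchy–Schwarz on one mode region**: `∫_{R_{i,n}} |f̂| ≤ |R_{i,n}|^{1/2} (∫_{R_{i,n}} |f̂|²)^{1/2}
= |R_{i,n}|^{1/2} ‖f_{i,n}‖ ≤ c (1+ε₀)^{3n/2} ‖f_{i,n}‖` (Plancherel on the region,
`norm_sq_modeProjection`). [cite: Tao2016AveragedNS, §4 Lemma 4.1 p. 22] -/
theorem lintegral_freqRegion_enorm_fourierFn_le (hε₀ : 0 < ε₀) (𝒟 : CascadeWaveletData ε₀ m)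
    (i : Fin m) (n : ℤ) (f : L2C) :
    ∫⁻ ξ in freqRegion 𝒟 i n, ‖fourierFn f ξ‖ₑ ≤
      ENNReal.ofReal (Real.sqrt ((1 + ε₀ / 2) ^ 3 *
          (volume (ball (0 : EuclideanSpace ℝ (Fin 3)) 1)).toReal)) *
        ENNReal.ofReal ((1 + ε₀) ^ ((3 : ℝ) * n / 2) * ‖modeProjection 𝒟 i n f‖) := by
  have hε : 0 < 1 + ε₀ := by linarith
  set c : ℝ := Real.sqrt ((1 + ε₀ / 2) ^ 3 *
    (volume (ball (0 : EuclideanSpace ℝ (Fin 3)) 1)).toReal) with hcdef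
  have hc0 : 0 ≤ c := Real.sqrt_nonneg _
  have hmeas : AEMeasurable (fun ξ => ‖fourierFn f ξ‖ₑ) (volume.restrict (freqRegion 𝒟 i n)) :=
    (aestronglyMeasurable_fourierFn f).aemeasurable.enorm.restrict
  -- Cauchy–Schwarz on the region
  have hCS : ∫⁻ ξ in freqRegion 𝒟 i n, ‖fourierFn f ξ‖ₑ ≤
      (volume (freqRegion 𝒟 i n)) ^ (1 / 2 : ℝ) *
        (∫⁻ ξ in freqRegion 𝒟 i n, ‖fourierFn f ξ‖ₑ ^ (2 : ℝ)) ^ (1 / 2 : ℝ) := by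
    have h := ENNReal.lintegral_mul_le_Lp_mul_Lq (volume.restrict (freqRegion 𝒟 i n))
      Real.HolderConjugate.two_two (aemeasurable_const (b := (1 : ℝ≥0∞))) hmeas
    simpa only [Pi.mul_apply, one_mul, ENNReal.one_rpow, setLIntegral_one] using h
  -- Plancherel on the region
  have hL2 : (∫⁻ ξ in freqRegion 𝒟 i n, ‖fourierFn f ξ‖ₑ ^ (2 : ℝ)) ^ (1 / 2 : ℝ) =
      ENNReal.ofReal ‖modeProjection 𝒟 i n f‖ := by
    have hint : Integrable (fun ξ => ‖fourierFn f ξ‖ ^ 2) volume :=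
      (memLp_two_iff_integrable_sq_norm (aestronglyMeasurable_fourierFn f)).1 (Lp.memLp (𝓕 f : L2C))
    have h1 : ∫⁻ ξ in freqRegion 𝒟 i n, ‖fourierFn f ξ‖ₑ ^ (2 : ℝ) =
        ENNReal.ofReal (‖modeProjection 𝒟 i n f‖ ^ 2) := by
      rw [norm_sq_modeProjection,
        ofReal_integral_eq_lintegral_ofReal hint.integrableOn (ae_of_all _ fun ξ => sq_nonneg _)]
      refine lintegral_congr fun ξ => ?_
      rw [ENNReal.rpow_two, ← ofReal_norm, ENNReal.ofReal_pow (norm_nonneg _)]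
    rw [h1, ENNReal.ofReal_rpow_of_nonneg (sq_nonneg _) (by norm_num), ← Real.sqrt_eq_rpow,
      Real.sqrt_sq (norm_nonneg _)]
  calc ∫⁻ ξ in freqRegion 𝒟 i n, ‖fourierFn f ξ‖ₑ
      ≤ (volume (freqRegion 𝒟 i n)) ^ (1 / 2 : ℝ) *
          (∫⁻ ξ in freqRegion 𝒟 i n, ‖fourierFn f ξ‖ₑ ^ (2 : ℝ)) ^ (1 / 2 : ℝ) := hCS
    _ ≤ ENNReal.ofReal (c * (1 + ε₀) ^ ((3 : ℝ) * n / 2)) * ENNReal.ofReal ‖modeProjection 𝒟 i n f‖ := by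
        rw [hL2]
        exact mul_le_mul' (volume_freqRegion_rpow_half_le hε₀ 𝒟 i n) le_rfl
    _ = ENNReal.ofReal c * ENNReal.ofReal ((1 + ε₀) ^ ((3 : ℝ) * n / 2) * ‖modeProjection 𝒟 i n f‖) := by
        rw [← ENNReal.ofReal_mul (by positivity), ← ENNReal.ofReal_mul hc0, mul_assoc]

/-! ### The sup norm through the `L¹` norm of the Fourier transform -/

/-- **`‖f‖_∞ ≤ ‖f̂‖_{L¹} ≤ c Σ_{i,n} (1+ε₀)^{3n/2} ‖f_{i,n}‖` for a field band-limited to the union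
of the mode regions** (in `ℝ≥0∞`): `∫ |f̂| = Σ_{i,n} ∫_{R_{i,n}} |f̂|` over the pairwise disjoint
regions, Cauchy–Schwarz on each, and — when the right-hand side is finite, so `f̂ ∈ L¹ ∩ L²` —
`‖𝓕⁻¹ f̂‖_∞ ≤ ∫ |f̂|` (accepted `SobolevEmbeddingHalf.enorm_fourierInv_toLp_le`). [cite: Tao2016AveragedNS, §4 Lemma 4.1 p. 22] -/
theorem eLpNorm_top_le_of_isBandLimited (hε₀ : 0 < ε₀) (𝒟 : CascadeWaveletData ε₀ m) {f : L2C}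
    (hf : IsBandLimited (⋃ p : Fin m × ℤ, freqRegion 𝒟 p.1 p.2) f) :
    eLpNorm f ⊤ volume ≤
      ENNReal.ofReal (Real.sqrt ((1 + ε₀ / 2) ^ 3 *
          (volume (ball (0 : EuclideanSpace ℝ (Fin 3)) 1)).toReal)) *
        ∑' p : Fin m × ℤ,
          ENNReal.ofReal ((1 + ε₀) ^ ((3 : ℝ) * p.2 / 2) * ‖modeProjection 𝒟 p.1 p.2 f‖) := by
  have hU : MeasurableSet (⋃ p : Fin m × ℤ, freqRegion 𝒟 p.1 p.2) :=
    measurableSet_iUnion_freqRegion 𝒟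
  have hd : Pairwise (Function.onFun Disjoint fun p : Fin m × ℤ => freqRegion 𝒟 p.1 p.2) :=
    fun _ _ hpq =>
    𝒟.disjoint_freqRegion hε₀ fun h => hpq (Prod.ext (Prod.mk.inj h).1 (Prod.mk.inj h).2)
  -- the `L¹` norm of `f̂` is bounded by the right-hand side
  have hL1 : ∫⁻ ξ, ‖fourierFn f ξ‖ₑ ≤
      ENNReal.ofReal (Real.sqrt ((1 + ε₀ / 2) ^ 3 *
          (volume (ball (0 : EuclideanSpace ℝ (Fin 3)) 1)).toReal)) *
        ∑' p : Fin m × ℤ,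
          ENNReal.ofReal ((1 + ε₀) ^ ((3 : ℝ) * p.2 / 2) * ‖modeProjection 𝒟 p.1 p.2 f‖) := by
    calc ∫⁻ ξ, ‖fourierFn f ξ‖ₑ
        = ∫⁻ ξ in ⋃ p : Fin m × ℤ, freqRegion 𝒟 p.1 p.2, ‖fourierFn f ξ‖ₑ := by
          rw [← lintegral_indicator hU]
          refine lintegral_congr_ae ?_
          filter_upwards [hf] with ξ hξ
          by_cases h : ξ ∈ ⋃ p : Fin m × ℤ, freqRegion 𝒟 p.1 p.2
          · rw [indicator_of_mem h]
          · rw [indicator_of_notMem h, hξ h, enorm_zero]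
      _ = ∑' p : Fin m × ℤ, ∫⁻ ξ in freqRegion 𝒟 p.1 p.2, ‖fourierFn f ξ‖ₑ :=
          lintegral_iUnion (fun p : Fin m × ℤ => measurableSet_freqRegion 𝒟 p.1 p.2) hd _
      _ ≤ ∑' p : Fin m × ℤ, ENNReal.ofReal (Real.sqrt ((1 + ε₀ / 2) ^ 3 *
            (volume (ball (0 : EuclideanSpace ℝ (Fin 3)) 1)).toReal)) *
            ENNReal.ofReal ((1 + ε₀) ^ ((3 : ℝ) * p.2 / 2) * ‖modeProjection 𝒟 p.1 p.2 f‖) :=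
          ENNReal.tsum_le_tsum fun p => lintegral_freqRegion_enorm_fourierFn_le hε₀ 𝒟 p.1 p.2 f
      _ = _ := ENNReal.tsum_mul_left
  rcases eq_top_or_lt_top (∫⁻ ξ, ‖fourierFn f ξ‖ₑ) with htop | hfin
  · rw [htop, top_le_iff] at hL1
    rw [hL1]
    exact le_top
  · have h1 : Integrable (fourierFn f) volume := ⟨aestronglyMeasurable_fourierFn f, hfin⟩
    have h2 : MemLp (fourierFn f) 2 volume := Lp.memLp (𝓕 f : L2C)
    have hLp : (𝓕⁻ (h2.toLp (fourierFn f)) : L2C) = f := by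
      have : h2.toLp (fourierFn f) = (𝓕 f : L2C) := Lp.toLp_coeFn (𝓕 f : L2C) h2
      rw [this]
      exact fourierInv_fourier_eq f
    have hae := SobolevEmbeddingHalf.enorm_fourierInv_toLp_le h1 h2
    rw [hLp] at hae
    rw [eLpNorm_exponent_top]
    exact (eLpNormEssSup_le_of_ae_enorm_bound hae).trans hL1

/-! ### The registered stub -/

/-- **Stub `supBound` (line `Sketch` of crux `AveragedTypeIBlowup`).** For a mild solution of the
cascade equation on `[0,S)` from a datum in the span of the wavelets, `u(t)` is band-limited to
the union of the (pairwise disjoint) mode regions (`isBandLimited_iUnion_freqRegion`), and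
`‖u(t)‖_∞ ≤ ‖û(t)‖_{L¹} ≤ c Σ_{i,n} (1+ε₀)^{3n/2} ‖u_{i,n}(t)‖` with `c = c(𝒟)` (Cauchy–Schwarz
on each region, of volume `≤ (1+ε₀)^{3n} (1+ε₀/2)³ |B(0,1)|`; `eLpNorm_top_le_of_isBandLimited`).
Stated in `ℝ≥0∞` (no summability hypothesis). [cite: Tao2016AveragedNS, §4 Lemma 4.1] -/
theorem stub_supBound :
    ∀ {ε₀ : ℝ}, 0 < ε₀ → ε₀ ≤ 1 → ∀ {m : ℕ} (𝒟 : CascadeWaveletData ε₀ m)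
      (α : Fin m → Fin m → Fin m → ℤ × ℤ × ℤ → ℝ), ∃ c : ℝ, 0 ≤ c ∧
      ∀ (i₀ : Fin m) (n₀ : ℤ) (A S : ℝ) (u : ℝ → L2C),
        IsMildSolutionFor (cascadeOperatorForm ε₀ 𝒟.ψ α) ((A : ℂ) • cascadeWavelet ε₀ (𝒟.ψ i₀) n₀) (Ico 0 S) u →
        ∀ t ∈ Ico 0 S, eLpNorm (u t) ⊤ volume ≤
          ENNReal.ofReal c * ∑' p : Fin m × ℤ,
            ENNReal.ofReal ((1 + ε₀) ^ ((3 : ℝ) * p.2 / 2) * ‖modeProjection 𝒟 p.1 p.2 (u t)‖) := by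
  intro ε₀ hε₀ _ m 𝒟 α
  refine ⟨Real.sqrt ((1 + ε₀ / 2) ^ 3 * (volume (ball (0 : EuclideanSpace ℝ (Fin 3)) 1)).toReal),
    Real.sqrt_nonneg _, fun i₀ n₀ A S u hu t ht => ?_⟩
  exact eLpNorm_top_le_of_isBandLimited hε₀ 𝒟
    (isBandLimited_iUnion_freqRegion hε₀ 𝒟 α i₀ n₀ A S u hu ht)

end Summit.NavierStokesRegularity.NavierStokesRegularity.Theorems.PerpetualPumpAveragedTypeIBlowup

end
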